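import Summits.BirchSwinnertonDyer.BirchSwinnertonDyer.Theorems.KolyvaginDepthDoorDepthTableRankTwo817a1TwistBSDQuotientUniform
import Summits.BirchSwinnertonDyer.BirchSwinnertonDyer.Theorems.KolyvaginDepthDoorDepthTableRankTwo997c1TwistBSDQuotientUniform
import Summits.BirchSwinnertonDyer.BirchSwinnertonDyer.Theorems.KolyvaginDepthDoorDepthTableRowsIntrinsic4
import Summits.BirchSwinnertonDyer.BirchSwinnertonDyer.Theorems.KolyvaginDepthDoorDepthTableIntrinsicSemistable
import HarnessLib

/-!
# Route `KolyvaginDepthDoor`, crux `KolyvaginDepthSupplyKN` (stmt-BirchSwinnertonDyer-22820) —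
# DEPTH TABLE v16: W. Zhang's ♠ cell, rank two (part 3) — the SEMISTABLE rows `817a1`, `997c1`, `707a1`, `997b1` at EVERY `11 ≤ p < 1000`: the hypotheses on the prime reduced to
# «good reduction» and «ordinary» (tower surjectivity is PRINT: Mazur 1978 Thm. 4 + Serre 1972 Prop. 21, granted Mazur's torsion theorem by name)

Helper file of the lead prover of line `levelone` (kdd-p1 g20; `--supports stmt-BirchSwinnertonDyer-22820
--as helper`); it closes nothing and BSD is NOT proved by it.

The intrinsic rows (`C<label>.cruxBody_intrinsic_at` / `cruxBody_LValue_intrinsic_at`) keep «`ρ_{E,p^n}` onto» as a hypothesis, certified in the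
tree only at the prime of record. For a SEMISTABLE curve it is print at every `p ≥ 11` (`tower_surjective_of_semistable_of_eleven_le`, file
`…DepthTableIntrinsicSemistable`). Per curve below: for EVERY prime `11 ≤ p < 1000` of GOOD ORDINARY reduction (the only `p`-hypotheses; Kodaira–Néron
/ ♠ (1) hold at every `p ≥ 5`, ♠ (2) is semistability), EVERY Heegner field `K` (`d_K ∉ {−3,−4}`, `p ∤ d_K`, any parity) and ANY globally minimal model
`T` of `E^{(d_K)}`, the rank-one BSD-quotient datum (even rank) / the rank-zero `L`-value datum (odd rank) of `T` at `p` gives the clause of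
`KolyvaginDepthSupplyKN` at the curve VERBATIM.

CONDITIONAL on Mazur 1977 Thm. 8 (`mazur_torsion`), Stein–Wuthrich 2013 Thm. 1.1, W. Zhang 2014 L8.4 (1) / 9.1, Burungale–Castella–Skinner 2025
Cor. 1.3.1 / Skinner 2016 Thm. C and GZK, BY NAME; per curve; nothing class-wide (the open stub (S♭) is untouched); BSD is NOT proved by any of this.

References: [Mazur1977] Thm. 8; [Mazur1978] Thm. 4; [Serre1972] §5.4 Prop. 21; [SteinWuthrich2013] Thm. 1.1; [WZhang2014] L8.4 (1), Thm. 9.1;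
[BurungaleCastellaSkinner2025] Cor. 1.3.1; [Skinner2016PacificMC] Thm. C; [CremonaAlgorithms1997] Table 1.
-/

set_option linter.dupNamespace false

noncomputable section

open scoped Classical NumberField

namespace Summit.BirchSwinnertonDyer.BirchSwinnertonDyer.Theorems.KolyvaginDepthDoor

open Literature.NumberTheory.EllipticCurves Literature.NumberTheory.EllipticCurves.ModularForms
  WeierstrassCurve NumberField IsDedekindDomain
open Summit.BirchSwinnertonDyer.BirchSwinnertonDyer.Theorems
open Summit.BirchSwinnertonDyer.BirchSwinnertonDyer.Rank2Observatory
open Summit.BirchSwinnertonDyer.BirchSwinnertonDyer.Rank1Residual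
open Summit.BirchSwinnertonDyer.Rank1Residual.Additive

namespace C817a1

/-- **`817a1` (semistable) — THE INTRINSIC ROW AT EVERY `11 ≤ p < 1000`, hypotheses on `p` reduced to GOOD + ORDINARY** (depth table v16; Mazur
1978 Thm. 4 + Serre Prop. 21 make `ρ_{E,p^n}` onto at every `p ≥ 11`, granted `mazur_torsion` by name). For every prime `11 ≤ p < 1000` of good
ordinary reduction, every imaginary quadratic Heegner field `K` for `N = 817` (`d_K ∉ {−3,−4}`, `p ∤ d_K`) and ANY globally minimal model `T` of
`E^{(d_K)}`: «`ord_{s=1} L(E^{(d_K)}, s) = 1` ∧ `ord_p(L'(T,1)/(Ω_T·Reg_T)) ≤ 1`» ⟹ the clause of `KolyvaginDepthSupplyKN` at `W = 817a1` VERBATIM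
(`cruxBody_of_twistBSDQuotient_intrinsic_semistable`). CONDITIONAL on `mazur_torsion`, Stein–Wuthrich Thm. 1.1, W. Zhang L8.4 (1) / 9.1, BCS Cor. 1.3.1,
GZK by name; per curve; nothing class-wide; BSD is not proved by it. [cite: Mazur1978, Thm. 4 (p. 131)] [cite: SteinWuthrich2013, Thm. 1.1 (p. 1758)]
[cite: BurungaleCastellaSkinner2025, Cor. 1.3.1 (p. 4)] [cite: CremonaAlgorithms1997, Table 1 (817a1)] -/
theorem cruxBody_intrinsic_of_eleven_le
    (hMT : ∀ V : WeierstrassCurve ℚ, mazur_torsion V)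
    (hSW : SteinWuthrich2013_sha_inf_torsionBy_eq_bot_of_two_le_rank)
    (h84 : Literature.NumberTheory.EllipticCurves.WZhang2014_lemma84_exists_minimal_kolyvaginClass_one_selmerCard)
    (hBCS : BurungaleCastellaSkinner2025.cor131_padicValRat_bsd_rank_le_one)
    (hGZK : rank_eq_analyticRank_of_analyticRank_le_one)
    (p : ℕ) [hp : Fact p.Prime] (h11 : 11 ≤ p) (hp1000 : p < 1000)
    (hgood : haveI := isElliptic_c817a1; haveI := isGloballyMinimal_c817a1; ((⟨0, 1, 1, 1, 6⟩ : WeierstrassCurve ℤ).map (Int.castRingHom ℚ)).HasGoodReductionAtPrime p)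
    (hord : haveI := isElliptic_c817a1; haveI := isGloballyMinimal_c817a1; ¬ (p : ℤ) ∣ ((⟨0, 1, 1, 1, 6⟩ : WeierstrassCurve ℤ).map (Int.castRingHom ℚ)).frobeniusTrace p)
    (K : Type) [Field K] [NumberField K] (hK : IsImaginaryQuadratic K)
    (hD3 : NumberField.discr K ≠ -3) (hD4 : NumberField.discr K ≠ -4) (hpD : ¬ ((p : ℤ) ∣ NumberField.discr K))
    (hH : SatisfiesHeegnerHypothesis 817 K)
    (T : WeierstrassCurve ℚ) [T.IsElliptic] [T.IsGloballyMinimal] (C : WeierstrassCurve.VariableChange ℚ)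
    (hC : C • T = ((⟨0, 1, 1, 1, 6⟩ : WeierstrassCurve ℤ).map (Int.castRingHom ℚ)).quadraticTwist (NumberField.discr K : ℚ))
    (hTr : (((⟨0, 1, 1, 1, 6⟩ : WeierstrassCurve ℤ).map (Int.castRingHom ℚ)).quadraticTwist (NumberField.discr K : ℚ)).analyticRank = 1)
    (hval : ∀ q : ℚ, T.leadingLCoeff / ((T.realPeriodRat * T.regulator : ℝ) : ℂ) = (q : ℂ) → padicValRat p q ≤ 1) :
    haveI := isElliptic_c817a1; haveI := isGloballyMinimal_c817a1;
    ∃ (p : ℕ) (hp : Fact p.Prime), 5 ≤ p ∧ ((⟨0, 1, 1, 1, 6⟩ : WeierstrassCurve ℤ).map (Int.castRingHom ℚ)).HasGoodReductionAtPrime p ∧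
      ¬ (p : ℤ) ∣ ((⟨0, 1, 1, 1, 6⟩ : WeierstrassCurve ℤ).map (Int.castRingHom ℚ)).frobeniusTrace p ∧ (∀ n : ℕ, ((⟨0, 1, 1, 1, 6⟩ : WeierstrassCurve ℤ).map (Int.castRingHom ℚ)).HasSurjectiveModNGaloisRep (p ^ n : ℕ)) ∧
      (∀ v : HeightOneSpectrum (𝓞 ℚ), ((⟨0, 1, 1, 1, 6⟩ : WeierstrassCurve ℤ).map (Int.castRingHom ℚ)).HasMultiplicativeReductionAt v →
        ¬ p ∣ ((⟨0, 1, 1, 1, 6⟩ : WeierstrassCurve ℤ).map (Int.castRingHom ℚ)).ordMinimalDiscriminant v) ∧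
      ∃ (K : Type) (_ : Field K) (_ : NumberField K), IsImaginaryQuadratic K ∧
        NumberField.discr K ≠ -3 ∧ NumberField.discr K ≠ -4 ∧
        ∃ (_ : NeZero (((⟨0, 1, 1, 1, 6⟩ : WeierstrassCurve ℤ).map (Int.castRingHom ℚ)).conductorNorm ℤ)), SatisfiesHeegnerHypothesis (((⟨0, 1, 1, 1, 6⟩ : WeierstrassCurve ℤ).map (Int.castRingHom ℚ)).conductorNorm ℤ) K ∧
        ∃ (Dt : ModularParametrizationData ((⟨0, 1, 1, 1, 6⟩ : WeierstrassCurve ℤ).map (Int.castRingHom ℚ)) (((⟨0, 1, 1, 1, 6⟩ : WeierstrassCurve ℤ).map (Int.castRingHom ℚ)).conductorNorm ℤ)) (β : ℤ) (ι : K →+* ℂ) (n₁ : ℕ)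
          (d : KolyvaginHeegnerData Dt β ι n₁), Squarefree n₁ ∧
          (∀ q ∈ n₁.primeFactors, Zhang2014.IsKolyvaginPrime (((⟨0, 1, 1, 1, 6⟩ : WeierstrassCurve ℤ).map (Int.castRingHom ℚ)).conductorNorm ℤ) ((⟨0, 1, 1, 1, 6⟩ : WeierstrassCurve ℤ).map (Int.castRingHom ℚ)) K p q) ∧
          d.kolyvaginClass hp.out 1 ≠ 0 ∧
          (n₁.primeFactors.card + 1 ≤ ((⟨0, 1, 1, 1, 6⟩ : WeierstrassCurve ℤ).map (Int.castRingHom ℚ)).mordellWeilRank ∨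
            (n₁.primeFactors.card ≤ ((⟨0, 1, 1, 1, 6⟩ : WeierstrassCurve ℤ).map (Int.castRingHom ℚ)).mordellWeilRank ∧
              n₁.primeFactors.card + 1 ≤ (((⟨0, 1, 1, 1, 6⟩ : WeierstrassCurve ℤ).map (Int.castRingHom ℚ)).quadraticTwist (NumberField.discr K : ℚ)).mordellWeilRank)) := by
  haveI := isElliptic_c817a1; haveI := isGloballyMinimal_c817a1
  haveI iNZ : NeZero (((⟨0, 1, 1, 1, 6⟩ : WeierstrassCurve ℤ).map (Int.castRingHom ℚ)).conductorNorm ℤ) := neZero_conductorNorm_of_isElliptic _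
  have hsp := spadeOne_of_five_le p (by omega)
  have hHN : SatisfiesHeegnerHypothesis (((⟨0, 1, 1, 1, 6⟩ : WeierstrassCurve ℤ).map (Int.castRingHom ℚ)).conductorNorm ℤ) K := by rw [conductorNorm_eq]; exact hH
  exact cruxBody_of_twistBSDQuotient_intrinsic_semistable hMT hSW h84 hBCS hGZK _ hsp.2 not_hasCM KernelCertsR01.C817a1.two_le_rank
    (by rw [conductorNorm_eq]; norm_num) p h11 hp1000 hgood hord (kodairaNeron_of_five_le p (by omega)) hsp.1 K hK hD3 hD4 hpD hHN T C hC hTr 1 KernelCertsR01.C817a1.two_le_rank hval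

end C817a1

namespace C997c1

/-- **`997c1` (semistable) — THE INTRINSIC ROW AT EVERY `11 ≤ p < 1000`, hypotheses on `p` reduced to GOOD + ORDINARY** (depth table v16; Mazur
1978 Thm. 4 + Serre Prop. 21 make `ρ_{E,p^n}` onto at every `p ≥ 11`, granted `mazur_torsion` by name). For every prime `11 ≤ p < 1000` of good
ordinary reduction, every imaginary quadratic Heegner field `K` for `N = 997` (`d_K ∉ {−3,−4}`, `p ∤ d_K`) and ANY globally minimal model `T` of
`E^{(d_K)}`: «`ord_{s=1} L(E^{(d_K)}, s) = 1` ∧ `ord_p(L'(T,1)/(Ω_T·Reg_T)) ≤ 1`» ⟹ the clause of `KolyvaginDepthSupplyKN` at `W = 997c1` VERBATIM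
(`cruxBody_of_twistBSDQuotient_intrinsic_semistable`). CONDITIONAL on `mazur_torsion`, Stein–Wuthrich Thm. 1.1, W. Zhang L8.4 (1) / 9.1, BCS Cor. 1.3.1,
GZK by name; per curve; nothing class-wide; BSD is not proved by it. [cite: Mazur1978, Thm. 4 (p. 131)] [cite: SteinWuthrich2013, Thm. 1.1 (p. 1758)]
[cite: BurungaleCastellaSkinner2025, Cor. 1.3.1 (p. 4)] [cite: CremonaAlgorithms1997, Table 1 (997c1)] -/
theorem cruxBody_intrinsic_of_eleven_le
    (hMT : ∀ V : WeierstrassCurve ℚ, mazur_torsion V)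
    (hSW : SteinWuthrich2013_sha_inf_torsionBy_eq_bot_of_two_le_rank)
    (h84 : Literature.NumberTheory.EllipticCurves.WZhang2014_lemma84_exists_minimal_kolyvaginClass_one_selmerCard)
    (hBCS : BurungaleCastellaSkinner2025.cor131_padicValRat_bsd_rank_le_one)
    (hGZK : rank_eq_analyticRank_of_analyticRank_le_one)
    (p : ℕ) [hp : Fact p.Prime] (h11 : 11 ≤ p) (hp1000 : p < 1000)
    (hgood : haveI := isElliptic_c997c1; haveI := isGloballyMinimal_c997c1; ((⟨0, -1, 1, -24, 54⟩ : WeierstrassCurve ℤ).map (Int.castRingHom ℚ)).HasGoodReductionAtPrime p)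
    (hord : haveI := isElliptic_c997c1; haveI := isGloballyMinimal_c997c1; ¬ (p : ℤ) ∣ ((⟨0, -1, 1, -24, 54⟩ : WeierstrassCurve ℤ).map (Int.castRingHom ℚ)).frobeniusTrace p)
    (K : Type) [Field K] [NumberField K] (hK : IsImaginaryQuadratic K)
    (hD3 : NumberField.discr K ≠ -3) (hD4 : NumberField.discr K ≠ -4) (hpD : ¬ ((p : ℤ) ∣ NumberField.discr K))
    (hH : SatisfiesHeegnerHypothesis 997 K)
    (T : WeierstrassCurve ℚ) [T.IsElliptic] [T.IsGloballyMinimal] (C : WeierstrassCurve.VariableChange ℚ)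
    (hC : C • T = ((⟨0, -1, 1, -24, 54⟩ : WeierstrassCurve ℤ).map (Int.castRingHom ℚ)).quadraticTwist (NumberField.discr K : ℚ))
    (hTr : (((⟨0, -1, 1, -24, 54⟩ : WeierstrassCurve ℤ).map (Int.castRingHom ℚ)).quadraticTwist (NumberField.discr K : ℚ)).analyticRank = 1)
    (hval : ∀ q : ℚ, T.leadingLCoeff / ((T.realPeriodRat * T.regulator : ℝ) : ℂ) = (q : ℂ) → padicValRat p q ≤ 1) :
    haveI := isElliptic_c997c1; haveI := isGloballyMinimal_c997c1;
    ∃ (p : ℕ) (hp : Fact p.Prime), 5 ≤ p ∧ ((⟨0, -1, 1, -24, 54⟩ : WeierstrassCurve ℤ).map (Int.castRingHom ℚ)).HasGoodReductionAtPrime p ∧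
      ¬ (p : ℤ) ∣ ((⟨0, -1, 1, -24, 54⟩ : WeierstrassCurve ℤ).map (Int.castRingHom ℚ)).frobeniusTrace p ∧ (∀ n : ℕ, ((⟨0, -1, 1, -24, 54⟩ : WeierstrassCurve ℤ).map (Int.castRingHom ℚ)).HasSurjectiveModNGaloisRep (p ^ n : ℕ)) ∧
      (∀ v : HeightOneSpectrum (𝓞 ℚ), ((⟨0, -1, 1, -24, 54⟩ : WeierstrassCurve ℤ).map (Int.castRingHom ℚ)).HasMultiplicativeReductionAt v →
        ¬ p ∣ ((⟨0, -1, 1, -24, 54⟩ : WeierstrassCurve ℤ).map (Int.castRingHom ℚ)).ordMinimalDiscriminant v) ∧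
      ∃ (K : Type) (_ : Field K) (_ : NumberField K), IsImaginaryQuadratic K ∧
        NumberField.discr K ≠ -3 ∧ NumberField.discr K ≠ -4 ∧
        ∃ (_ : NeZero (((⟨0, -1, 1, -24, 54⟩ : WeierstrassCurve ℤ).map (Int.castRingHom ℚ)).conductorNorm ℤ)), SatisfiesHeegnerHypothesis (((⟨0, -1, 1, -24, 54⟩ : WeierstrassCurve ℤ).map (Int.castRingHom ℚ)).conductorNorm ℤ) K ∧
        ∃ (Dt : ModularParametrizationData ((⟨0, -1, 1, -24, 54⟩ : WeierstrassCurve ℤ).map (Int.castRingHom ℚ)) (((⟨0, -1, 1, -24, 54⟩ : WeierstrassCurve ℤ).map (Int.castRingHom ℚ)).conductorNorm ℤ)) (β : ℤ) (ι : K →+* ℂ) (n₁ : ℕ)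
          (d : KolyvaginHeegnerData Dt β ι n₁), Squarefree n₁ ∧
          (∀ q ∈ n₁.primeFactors, Zhang2014.IsKolyvaginPrime (((⟨0, -1, 1, -24, 54⟩ : WeierstrassCurve ℤ).map (Int.castRingHom ℚ)).conductorNorm ℤ) ((⟨0, -1, 1, -24, 54⟩ : WeierstrassCurve ℤ).map (Int.castRingHom ℚ)) K p q) ∧
          d.kolyvaginClass hp.out 1 ≠ 0 ∧
          (n₁.primeFactors.card + 1 ≤ ((⟨0, -1, 1, -24, 54⟩ : WeierstrassCurve ℤ).map (Int.castRingHom ℚ)).mordellWeilRank ∨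
            (n₁.primeFactors.card ≤ ((⟨0, -1, 1, -24, 54⟩ : WeierstrassCurve ℤ).map (Int.castRingHom ℚ)).mordellWeilRank ∧
              n₁.primeFactors.card + 1 ≤ (((⟨0, -1, 1, -24, 54⟩ : WeierstrassCurve ℤ).map (Int.castRingHom ℚ)).quadraticTwist (NumberField.discr K : ℚ)).mordellWeilRank)) := by
  haveI := isElliptic_c997c1; haveI := isGloballyMinimal_c997c1
  haveI iNZ : NeZero (((⟨0, -1, 1, -24, 54⟩ : WeierstrassCurve ℤ).map (Int.castRingHom ℚ)).conductorNorm ℤ) := neZero_conductorNorm_of_isElliptic _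
  have hsp := spadeOne_of_five_le p (by omega)
  have hHN : SatisfiesHeegnerHypothesis (((⟨0, -1, 1, -24, 54⟩ : WeierstrassCurve ℤ).map (Int.castRingHom ℚ)).conductorNorm ℤ) K := by rw [conductorNorm_eq]; exact hH
  exact cruxBody_of_twistBSDQuotient_intrinsic_semistable hMT hSW h84 hBCS hGZK _ hsp.2 not_hasCM KernelCerts003.C997c1.two_le_rank
    (by rw [conductorNorm_eq]; norm_num) p h11 hp1000 hgood hord (kodairaNeron_of_five_le p (by omega)) hsp.1 K hK hD3 hD4 hpD hHN T C hC hTr 1 KernelCerts003.C997c1.two_le_rank hval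

end C997c1

namespace C707a1

/-- **`707a1` (semistable) — THE INTRINSIC ROW AT EVERY `11 ≤ p < 1000`, hypotheses on `p` reduced to GOOD + ORDINARY** (depth table v16; Mazur
1978 Thm. 4 + Serre Prop. 21 make `ρ_{E,p^n}` onto at every `p ≥ 11`, granted `mazur_torsion` by name). For every prime `11 ≤ p < 1000` of good
ordinary reduction, every imaginary quadratic Heegner field `K` for `N = 707` (`d_K ∉ {−3,−4}`, `p ∤ d_K`) and ANY globally minimal model `T` of
`E^{(d_K)}`: «`ord_{s=1} L(E^{(d_K)}, s) = 1` ∧ `ord_p(L'(T,1)/(Ω_T·Reg_T)) ≤ 1`» ⟹ the clause of `KolyvaginDepthSupplyKN` at `W = 707a1` VERBATIM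
(`cruxBody_of_twistBSDQuotient_intrinsic_semistable`). CONDITIONAL on `mazur_torsion`, Stein–Wuthrich Thm. 1.1, W. Zhang L8.4 (1) / 9.1, BCS Cor. 1.3.1,
GZK by name; per curve; nothing class-wide; BSD is not proved by it. [cite: Mazur1978, Thm. 4 (p. 131)] [cite: SteinWuthrich2013, Thm. 1.1 (p. 1758)]
[cite: BurungaleCastellaSkinner2025, Cor. 1.3.1 (p. 4)] [cite: CremonaAlgorithms1997, Table 1 (707a1)] -/
theorem cruxBody_intrinsic_of_eleven_le
    (hMT : ∀ V : WeierstrassCurve ℚ, mazur_torsion V)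
    (hSW : SteinWuthrich2013_sha_inf_torsionBy_eq_bot_of_two_le_rank)
    (h84 : Literature.NumberTheory.EllipticCurves.WZhang2014_lemma84_exists_minimal_kolyvaginClass_one_selmerCard)
    (hBCS : BurungaleCastellaSkinner2025.cor131_padicValRat_bsd_rank_le_one)
    (hGZK : rank_eq_analyticRank_of_analyticRank_le_one)
    (p : ℕ) [hp : Fact p.Prime] (h11 : 11 ≤ p) (hp1000 : p < 1000)
    (hgood : haveI := isElliptic_c707a1; haveI := isGloballyMinimal_c707a1; ((⟨0, 1, 1, -12, 12⟩ : WeierstrassCurve ℤ).map (Int.castRingHom ℚ)).HasGoodReductionAtPrime p)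
    (hord : haveI := isElliptic_c707a1; haveI := isGloballyMinimal_c707a1; ¬ (p : ℤ) ∣ ((⟨0, 1, 1, -12, 12⟩ : WeierstrassCurve ℤ).map (Int.castRingHom ℚ)).frobeniusTrace p)
    (K : Type) [Field K] [NumberField K] (hK : IsImaginaryQuadratic K)
    (hD3 : NumberField.discr K ≠ -3) (hD4 : NumberField.discr K ≠ -4) (hpD : ¬ ((p : ℤ) ∣ NumberField.discr K))
    (hH : SatisfiesHeegnerHypothesis 707 K)
    (T : WeierstrassCurve ℚ) [T.IsElliptic] [T.IsGloballyMinimal] (C : WeierstrassCurve.VariableChange ℚ)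
    (hC : C • T = ((⟨0, 1, 1, -12, 12⟩ : WeierstrassCurve ℤ).map (Int.castRingHom ℚ)).quadraticTwist (NumberField.discr K : ℚ))
    (hTr : (((⟨0, 1, 1, -12, 12⟩ : WeierstrassCurve ℤ).map (Int.castRingHom ℚ)).quadraticTwist (NumberField.discr K : ℚ)).analyticRank = 1)
    (hval : ∀ q : ℚ, T.leadingLCoeff / ((T.realPeriodRat * T.regulator : ℝ) : ℂ) = (q : ℂ) → padicValRat p q ≤ 1) :
    haveI := isElliptic_c707a1; haveI := isGloballyMinimal_c707a1;
    ∃ (p : ℕ) (hp : Fact p.Prime), 5 ≤ p ∧ ((⟨0, 1, 1, -12, 12⟩ : WeierstrassCurve ℤ).map (Int.castRingHom ℚ)).HasGoodReductionAtPrime p ∧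
      ¬ (p : ℤ) ∣ ((⟨0, 1, 1, -12, 12⟩ : WeierstrassCurve ℤ).map (Int.castRingHom ℚ)).frobeniusTrace p ∧ (∀ n : ℕ, ((⟨0, 1, 1, -12, 12⟩ : WeierstrassCurve ℤ).map (Int.castRingHom ℚ)).HasSurjectiveModNGaloisRep (p ^ n : ℕ)) ∧
      (∀ v : HeightOneSpectrum (𝓞 ℚ), ((⟨0, 1, 1, -12, 12⟩ : WeierstrassCurve ℤ).map (Int.castRingHom ℚ)).HasMultiplicativeReductionAt v →
        ¬ p ∣ ((⟨0, 1, 1, -12, 12⟩ : WeierstrassCurve ℤ).map (Int.castRingHom ℚ)).ordMinimalDiscriminant v) ∧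
      ∃ (K : Type) (_ : Field K) (_ : NumberField K), IsImaginaryQuadratic K ∧
        NumberField.discr K ≠ -3 ∧ NumberField.discr K ≠ -4 ∧
        ∃ (_ : NeZero (((⟨0, 1, 1, -12, 12⟩ : WeierstrassCurve ℤ).map (Int.castRingHom ℚ)).conductorNorm ℤ)), SatisfiesHeegnerHypothesis (((⟨0, 1, 1, -12, 12⟩ : WeierstrassCurve ℤ).map (Int.castRingHom ℚ)).conductorNorm ℤ) K ∧
        ∃ (Dt : ModularParametrizationData ((⟨0, 1, 1, -12, 12⟩ : WeierstrassCurve ℤ).map (Int.castRingHom ℚ)) (((⟨0, 1, 1, -12, 12⟩ : WeierstrassCurve ℤ).map (Int.castRingHom ℚ)).conductorNorm ℤ)) (β : ℤ) (ι : K →+* ℂ) (n₁ : ℕ)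
          (d : KolyvaginHeegnerData Dt β ι n₁), Squarefree n₁ ∧
          (∀ q ∈ n₁.primeFactors, Zhang2014.IsKolyvaginPrime (((⟨0, 1, 1, -12, 12⟩ : WeierstrassCurve ℤ).map (Int.castRingHom ℚ)).conductorNorm ℤ) ((⟨0, 1, 1, -12, 12⟩ : WeierstrassCurve ℤ).map (Int.castRingHom ℚ)) K p q) ∧
          d.kolyvaginClass hp.out 1 ≠ 0 ∧
          (n₁.primeFactors.card + 1 ≤ ((⟨0, 1, 1, -12, 12⟩ : WeierstrassCurve ℤ).map (Int.castRingHom ℚ)).mordellWeilRank ∨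
            (n₁.primeFactors.card ≤ ((⟨0, 1, 1, -12, 12⟩ : WeierstrassCurve ℤ).map (Int.castRingHom ℚ)).mordellWeilRank ∧
              n₁.primeFactors.card + 1 ≤ (((⟨0, 1, 1, -12, 12⟩ : WeierstrassCurve ℤ).map (Int.castRingHom ℚ)).quadraticTwist (NumberField.discr K : ℚ)).mordellWeilRank)) := by
  haveI := isElliptic_c707a1; haveI := isGloballyMinimal_c707a1
  haveI iNZ : NeZero (((⟨0, 1, 1, -12, 12⟩ : WeierstrassCurve ℤ).map (Int.castRingHom ℚ)).conductorNorm ℤ) := neZero_conductorNorm_of_isElliptic _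
  have hsp := spadeOne_of_five_le p (by omega)
  have hHN : SatisfiesHeegnerHypothesis (((⟨0, 1, 1, -12, 12⟩ : WeierstrassCurve ℤ).map (Int.castRingHom ℚ)).conductorNorm ℤ) K := by rw [conductorNorm_eq]; exact hH
  exact cruxBody_of_twistBSDQuotient_intrinsic_semistable hMT hSW h84 hBCS hGZK _ hsp.2 not_hasCM KernelCerts002.C707a1.two_le_rank
    (by rw [conductorNorm_eq]; norm_num) p h11 hp1000 hgood hord (kodairaNeron_of_five_le p (by omega)) hsp.1 K hK hD3 hD4 hpD hHN T C hC hTr 1 KernelCerts002.C707a1.two_le_rank hval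

end C707a1

namespace C997b1

/-- **`997b1` (semistable) — THE INTRINSIC ROW AT EVERY `11 ≤ p < 1000`, hypotheses on `p` reduced to GOOD + ORDINARY** (depth table v16; Mazur
1978 Thm. 4 + Serre Prop. 21 make `ρ_{E,p^n}` onto at every `p ≥ 11`, granted `mazur_torsion` by name). For every prime `11 ≤ p < 1000` of good
ordinary reduction, every imaginary quadratic Heegner field `K` for `N = 997` (`d_K ∉ {−3,−4}`, `p ∤ d_K`) and ANY globally minimal model `T` of
`E^{(d_K)}`: «`ord_{s=1} L(E^{(d_K)}, s) = 1` ∧ `ord_p(L'(T,1)/(Ω_T·Reg_T)) ≤ 1`» ⟹ the clause of `KolyvaginDepthSupplyKN` at `W = 997b1` VERBATIM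
(`cruxBody_of_twistBSDQuotient_intrinsic_semistable`). CONDITIONAL on `mazur_torsion`, Stein–Wuthrich Thm. 1.1, W. Zhang L8.4 (1) / 9.1, BCS Cor. 1.3.1,
GZK by name; per curve; nothing class-wide; BSD is not proved by it. [cite: Mazur1978, Thm. 4 (p. 131)] [cite: SteinWuthrich2013, Thm. 1.1 (p. 1758)]
[cite: BurungaleCastellaSkinner2025, Cor. 1.3.1 (p. 4)] [cite: CremonaAlgorithms1997, Table 1 (997b1)] -/
theorem cruxBody_intrinsic_of_eleven_le
    (hMT : ∀ V : WeierstrassCurve ℚ, mazur_torsion V)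
    (hSW : SteinWuthrich2013_sha_inf_torsionBy_eq_bot_of_two_le_rank)
    (h84 : Literature.NumberTheory.EllipticCurves.WZhang2014_lemma84_exists_minimal_kolyvaginClass_one_selmerCard)
    (hBCS : BurungaleCastellaSkinner2025.cor131_padicValRat_bsd_rank_le_one)
    (hGZK : rank_eq_analyticRank_of_analyticRank_le_one)
    (p : ℕ) [hp : Fact p.Prime] (h11 : 11 ≤ p) (hp1000 : p < 1000)
    (hgood : haveI := isElliptic_c997b1; haveI := isGloballyMinimal_c997b1; ((⟨0, -1, 1, -5, -3⟩ : WeierstrassCurve ℤ).map (Int.castRingHom ℚ)).HasGoodReductionAtPrime p)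
    (hord : haveI := isElliptic_c997b1; haveI := isGloballyMinimal_c997b1; ¬ (p : ℤ) ∣ ((⟨0, -1, 1, -5, -3⟩ : WeierstrassCurve ℤ).map (Int.castRingHom ℚ)).frobeniusTrace p)
    (K : Type) [Field K] [NumberField K] (hK : IsImaginaryQuadratic K)
    (hD3 : NumberField.discr K ≠ -3) (hD4 : NumberField.discr K ≠ -4) (hpD : ¬ ((p : ℤ) ∣ NumberField.discr K))
    (hH : SatisfiesHeegnerHypothesis 997 K)
    (T : WeierstrassCurve ℚ) [T.IsElliptic] [T.IsGloballyMinimal] (C : WeierstrassCurve.VariableChange ℚ)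
    (hC : C • T = ((⟨0, -1, 1, -5, -3⟩ : WeierstrassCurve ℤ).map (Int.castRingHom ℚ)).quadraticTwist (NumberField.discr K : ℚ))
    (hTr : (((⟨0, -1, 1, -5, -3⟩ : WeierstrassCurve ℤ).map (Int.castRingHom ℚ)).quadraticTwist (NumberField.discr K : ℚ)).analyticRank = 1)
    (hval : ∀ q : ℚ, T.leadingLCoeff / ((T.realPeriodRat * T.regulator : ℝ) : ℂ) = (q : ℂ) → padicValRat p q ≤ 1) :
    haveI := isElliptic_c997b1; haveI := isGloballyMinimal_c997b1;
    ∃ (p : ℕ) (hp : Fact p.Prime), 5 ≤ p ∧ ((⟨0, -1, 1, -5, -3⟩ : WeierstrassCurve ℤ).map (Int.castRingHom ℚ)).HasGoodReductionAtPrime p ∧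
      ¬ (p : ℤ) ∣ ((⟨0, -1, 1, -5, -3⟩ : WeierstrassCurve ℤ).map (Int.castRingHom ℚ)).frobeniusTrace p ∧ (∀ n : ℕ, ((⟨0, -1, 1, -5, -3⟩ : WeierstrassCurve ℤ).map (Int.castRingHom ℚ)).HasSurjectiveModNGaloisRep (p ^ n : ℕ)) ∧
      (∀ v : HeightOneSpectrum (𝓞 ℚ), ((⟨0, -1, 1, -5, -3⟩ : WeierstrassCurve ℤ).map (Int.castRingHom ℚ)).HasMultiplicativeReductionAt v →
        ¬ p ∣ ((⟨0, -1, 1, -5, -3⟩ : WeierstrassCurve ℤ).map (Int.castRingHom ℚ)).ordMinimalDiscriminant v) ∧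
      ∃ (K : Type) (_ : Field K) (_ : NumberField K), IsImaginaryQuadratic K ∧
        NumberField.discr K ≠ -3 ∧ NumberField.discr K ≠ -4 ∧
        ∃ (_ : NeZero (((⟨0, -1, 1, -5, -3⟩ : WeierstrassCurve ℤ).map (Int.castRingHom ℚ)).conductorNorm ℤ)), SatisfiesHeegnerHypothesis (((⟨0, -1, 1, -5, -3⟩ : WeierstrassCurve ℤ).map (Int.castRingHom ℚ)).conductorNorm ℤ) K ∧
        ∃ (Dt : ModularParametrizationData ((⟨0, -1, 1, -5, -3⟩ : WeierstrassCurve ℤ).map (Int.castRingHom ℚ)) (((⟨0, -1, 1, -5, -3⟩ : WeierstrassCurve ℤ).map (Int.castRingHom ℚ)).conductorNorm ℤ)) (β : ℤ) (ι : K →+* ℂ) (n₁ : ℕ)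
          (d : KolyvaginHeegnerData Dt β ι n₁), Squarefree n₁ ∧
          (∀ q ∈ n₁.primeFactors, Zhang2014.IsKolyvaginPrime (((⟨0, -1, 1, -5, -3⟩ : WeierstrassCurve ℤ).map (Int.castRingHom ℚ)).conductorNorm ℤ) ((⟨0, -1, 1, -5, -3⟩ : WeierstrassCurve ℤ).map (Int.castRingHom ℚ)) K p q) ∧
          d.kolyvaginClass hp.out 1 ≠ 0 ∧
          (n₁.primeFactors.card + 1 ≤ ((⟨0, -1, 1, -5, -3⟩ : WeierstrassCurve ℤ).map (Int.castRingHom ℚ)).mordellWeilRank ∨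
            (n₁.primeFactors.card ≤ ((⟨0, -1, 1, -5, -3⟩ : WeierstrassCurve ℤ).map (Int.castRingHom ℚ)).mordellWeilRank ∧
              n₁.primeFactors.card + 1 ≤ (((⟨0, -1, 1, -5, -3⟩ : WeierstrassCurve ℤ).map (Int.castRingHom ℚ)).quadraticTwist (NumberField.discr K : ℚ)).mordellWeilRank)) := by
  haveI := isElliptic_c997b1; haveI := isGloballyMinimal_c997b1
  haveI iNZ : NeZero (((⟨0, -1, 1, -5, -3⟩ : WeierstrassCurve ℤ).map (Int.castRingHom ℚ)).conductorNorm ℤ) := neZero_conductorNorm_of_isElliptic _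
  have hsp := spadeOne_of_five_le p (by omega)
  have hHN : SatisfiesHeegnerHypothesis (((⟨0, -1, 1, -5, -3⟩ : WeierstrassCurve ℤ).map (Int.castRingHom ℚ)).conductorNorm ℤ) K := by rw [conductorNorm_eq]; exact hH
  exact cruxBody_of_twistBSDQuotient_intrinsic_semistable hMT hSW h84 hBCS hGZK _ hsp.2 not_hasCM KernelCertsR01.C997b1.two_le_rank
    (by rw [conductorNorm_eq]; norm_num) p h11 hp1000 hgood hord (kodairaNeron_of_five_le p (by omega)) hsp.1 K hK hD3 hD4 hpD hHN T C hC hTr 1 KernelCertsR01.C997b1.two_le_rank hval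

end C997b1

end Summit.BirchSwinnertonDyer.BirchSwinnertonDyer.Theorems.KolyvaginDepthDoor

end
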